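import Mathlib
import HarnessLib
import Summits.CriticalPhenomena.CardyFormulaZ2.Theses.CardySelfDualSegment
import Literature.Probability.Percolation.CornerPercolation
import Literature.Barriers.CriticalPhenomena.EmbeddingModulusUniquenessProofs
import Literature.Probability.RandomPlanarGeometry.ConformalRectangleProofs
import Literature.Probability.RandomPlanarGeometry.CardyFunction
import Literature.Probability.RandomPlanarGeometry.DiamondShearChart
import Summits.CriticalPhenomena.CardyFormulaZ2.Theorems.SegmentOpen.Negative.NormOne
import Summits.CriticalPhenomena.CardyFormulaZ2.Theorems.CardySelfDualSegmentSegmentOpenStubCrossingProbPolynomial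
import Summits.CriticalPhenomena.CardyFormulaZ2.Theorems.CardySelfDualSegmentSegmentOpenStubVitaliJets
import Summits.CriticalPhenomena.CardyFormulaZ2.Theorems.CardySelfDualSegmentSegmentOpenStubGoodSetNhdsZeroOfJets
import Summits.CriticalPhenomena.CardyFormulaZ2.Theorems.CardySelfDualSegmentSegmentOpenStubGoodSetUnivOfGlobalJets
import Summits.CriticalPhenomena.CardyFormulaZ2.Theorems.CardySelfDualSegmentSegmentOpenJetConvOfLimits
import Summits.CriticalPhenomena.CardyFormulaZ2.Theorems.CardySelfDualSegmentSegmentOpenSmirnovGermForm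
import Summits.CriticalPhenomena.CardyFormulaZ2.Theorems.CardyQContinuationJetLimitLemma
import Summits.CriticalPhenomena.CardyFormulaZ2.Theorems.CardySelfDualSegmentSegmentOpenGlobalJetsCurve

import Summits.CriticalPhenomena.CardyFormulaZ2.Theorems.CardySelfDualSegmentSegmentOpenJetIdentificationOfTargetLemmas
/-!
# Crux `SegmentOpen` (stmt-CriticalPhenomena-5471), line `Sketch` — census: under S4w, the Target gives JI

Lead c5, reshape 7 (GLOBAL JETS).  The identification stub JI `stub_jetIdentification` posits ONE
real-analytic modulus curve `α : [0,1] → ℍ` along which the perturbation series of the coefficient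
limits of every conformal rectangle sums, near `0⁺`, to the sheared Cardy value.  Here we show
that, under the pointwise complex bound S4w `stub_localComplexBound` (hypothesis, NOT claimed),
JI FOLLOWS from the route's `Target` (`G = [0,1]`): so, given S4w, the line's research residue
JC ∧ JI is EQUIVALENT to the Target (JC: `jetConv_of_localComplexBound_of_limits`, p134469; the
converse direction is GJ, p134197) — reshape 7 loses nothing, and its jet form is exactly the
order-by-order presentation of linear universality at the Smirnov point.  On the way
(`exists_analytic_modulus_curve`): under S4w and the Target the modulus motion `t ↦ α(t)` of the
corner family is REAL-ANALYTIC on `[0,1]` (diamond chart of `Literature/…/DiamondShearChart` +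
Vitali with jets on a connected complex neighbourhood of the segment + the analytic inverse
function theorem; part 1: `CardySelfDualSegmentSegmentOpenJetIdentificationOfTargetLemmas.lean`).
-/

noncomputable section

namespace Summit.CriticalPhenomena.CardyFormulaZ2.Theorems

open Literature.Probability Literature.Barriers.CriticalPhenomena
open Literature.Probability.RandomPlanarGeometry (ConformalRectangle ConformalEquiv MarkedDomain)
open Filter Set Topology MeasureTheory
open UpperHalfPlane (upperHalfPlaneSet)


open JetIdentificationOfTarget GoodSetUnivOfGlobalJets JetConvOfLimits in
/-- **Under S4w, the Target gives the modulus curve of JI — and it is real-analytic.**  Assume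
S4w (verbatim `stub_localComplexBound`; hypothesis, NOT claimed) and the route's `Target`.  Then
the conclusion of JI `stub_jetIdentification` holds: there is a modulus curve `α`, real-analytic
on `[0,1]` with values in `ℍ` — namely the Target's (unique) modulus function, read through the
diamond chart — such that for every `R'`, every real-analytic `M` computing the cross-ratios of the
sheared rectangles `φ_β R'`, and every sequence `a` of coefficient limits of the crossing
polynomials of `R'`, the perturbation series `Σ a k s^k` sums to `F(M(α s))` for all small `s ≥ 0`.
Hence, given S4w, (JC ∧ JI) ⟺ Target (with `jetConv_of_localComplexBound_of_limits` and GJ). -/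
theorem jetIdentification_of_target :
    (∀ (t₀ : unitInterval) (R : ConformalRectangle), ∃ r > 0, ∃ δ₁ > 0, ∃ C : ℝ, ∀ δ : ℝ,
      0 < δ → δ < δ₁ → ∀ p : Polynomial ℝ,
        (∀ t : unitInterval, Percolation.cornerCrossingProb t R δ = p.eval (t : ℝ)) →
        ∀ z ∈ Metric.ball ((t₀ : ℝ) : ℂ) r, ‖(p.map (algebraMap ℝ ℂ)).eval z‖ ≤ C) →
    Summit.CriticalPhenomena.CardyFormulaZ2.Theses.CardySelfDualSegment.Target →
    ∃ α : ℝ → ℂ, AnalyticOnNhd ℝ α (Set.Icc 0 1) ∧ (∀ s ∈ Set.Icc (0 : ℝ) 1, 0 < (α s).im) ∧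
      ∀ (R' : ConformalRectangle) (M : ℂ → ℝ), AnalyticOnNhd ℝ M {β : ℂ | 0 < β.im} →
        (∀ β : ℂ, 0 < β.im → ∀ (R : ConformalRectangle)
            (φ : ConformalEquiv UpperHalfPlane.upperHalfPlaneSet R.carrier) (x : Fin 4 → ℝ),
            R.carrier = moduliShear β '' R'.carrier → (∀ i, R.pt i = moduliShear β (R'.pt i)) →
            R.IsUniformizing φ x → RandomPlanarGeometry.crossRatio x = M β) →
        ∀ a : ℕ → ℝ,
          (∀ k : ℕ, ∀ ε > 0, ∃ δ₀ > 0, ∀ δ : ℝ, 0 < δ → δ < δ₀ → ∀ p : Polynomial ℝ,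
              (∀ t : unitInterval, Percolation.cornerCrossingProb t R' δ = p.eval (t : ℝ)) →
              |p.coeff k - a k| < ε) →
          ∃ ε > 0, ∀ s : ℝ, 0 ≤ s → s < ε →
            HasSum (fun k : ℕ => a k * s ^ k) (RandomPlanarGeometry.cardyFunction (M (α s))) := by
  classical
  intro h4 hT
  -- Target: every `t` is good, with modulus `β t` on the unit circle: `β t = circleParam (σ t)`
  rw [target_iff_forall_mem_goodSet] at hT
  choose β hβim hβC using hT
  have hnorm : ∀ t : unitInterval, ‖β t‖ = 1 := fun t =>
    SegmentOpen.Negative.norm_eq_one_of_cardyMod t (hβim t) (hβC t)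
  choose σ hσ hβσ using fun t =>
    RandomPlanarGeometry.exists_circleParam_of_norm_eq_one (hnorm t) (hβim t)
  -- crossing polynomials of a rectangle (S1) and their specification
  have hPex : ∀ R : ConformalRectangle, ∃ P : ℝ → Polynomial ℝ, ∀ δ : ℝ, 0 < δ →
      ∀ s : unitInterval, Percolation.cornerCrossingProb s R δ = (P δ).eval (s : ℝ) := fun R =>
    ⟨fun δ => if hδ : 0 < δ then Classical.choose (stub_crossingProbPolynomial R δ hδ) else 0,
      fun δ hδ s => by
        simp only [dif_pos hδ]
        exact Classical.choose_spec (stub_crossingProbPolynomial R δ hδ) s⟩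
  -- the crossing limits given by the Target, in terms of a modulus function
  have hlimM : ∀ (R' : ConformalRectangle) (M : ℂ → ℝ),
      (∀ β : ℂ, 0 < β.im → ∀ (R : ConformalRectangle)
          (φ : ConformalEquiv UpperHalfPlane.upperHalfPlaneSet R.carrier) (x : Fin 4 → ℝ),
          R.carrier = moduliShear β '' R'.carrier → (∀ i, R.pt i = moduliShear β (R'.pt i)) →
          R.IsUniformizing φ x → RandomPlanarGeometry.crossRatio x = M β) →
      ∀ t : unitInterval, Tendsto (Percolation.cornerCrossingProb t R') (𝓝[>] 0)
        (𝓝 (RandomPlanarGeometry.cardyFunction (M (β t)))) := by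
    intro R' M hM t
    obtain ⟨Q, ψ, y, hc, hp, hψ⟩ := exists_shear_presentation R' (hβim t).ne'
    rw [← hM (β t) (hβim t) Q ψ y hc hp hψ]
    exact hβC t Q R' ψ y hc hp hψ
  -- Step 1: the diamond chart `c s = F(λ(is))` and the limit function of the diamond
  obtain ⟨D, hD⟩ := RandomPlanarGeometry.exists_diamond_shear_chart
  set c : ℝ → ℝ := fun s =>
    RandomPlanarGeometry.cardyFunction (RandomPlanarGeometry.KlebanZagier.lamR s) with hcdef
  have hlimD : ∀ t : unitInterval, Tendsto (Percolation.cornerCrossingProb t D) (𝓝[>] 0)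
      (𝓝 (c (σ t))) := fun t => by
    obtain ⟨Q, ψ, y, hc, hp, hψ⟩ := exists_shear_presentation D (hβim t).ne'
    have hcr := hD (σ t) (hσ t) Q ψ y (by rw [hc, hβσ]) (fun i => by rw [hp i, hβσ]) hψ
    have h := hβC t Q D ψ y hc hp hψ
    rwa [hcr] at h
  obtain ⟨PD, hPD⟩ := hPex D
  -- coefficient convergence for the diamond (JC is necessary under S4w, p134469)
  have huseq : ∃ u : ℕ → unitInterval, Tendsto u atTop (𝓝 0) ∧ (∀ n, u n ≠ 0) ∧
      ∀ n, ∃ L : ℝ, Tendsto (Percolation.cornerCrossingProb (u n) D) (𝓝[>] 0) (𝓝 L) := by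
    have hmem : ∀ n : ℕ, (1 : ℝ) / ((n : ℝ) + 2) ∈ Icc (0 : ℝ) 1 := fun n => by
      constructor
      · positivity
      · rw [div_le_one (by positivity)]; linarith [n.cast_nonneg (α := ℝ)]
    refine ⟨fun n => ⟨(1 : ℝ) / ((n : ℝ) + 2), hmem n⟩, ?_, fun n h => ?_, fun n => ⟨_, hlimD _⟩⟩
    · rw [Metric.tendsto_atTop]
      intro ε hε
      obtain ⟨N, hN⟩ := exists_nat_gt (1 / ε)
      refine ⟨N, fun n hn => ?_⟩
      rw [Subtype.dist_eq, Set.Icc.coe_zero, dist_zero_right, Real.norm_eq_abs,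
        abs_of_pos (by positivity), div_lt_iff₀ (by positivity)]
      have hN' : (N : ℝ) ≤ n := by exact_mod_cast hn
      have h1 : 1 / ε < (n : ℝ) + 2 := by linarith
      calc (1 : ℝ) = (1 / ε) * ε := by field_simp
        _ < ((n : ℝ) + 2) * ε := by gcongr
        _ = ε * ((n : ℝ) + 2) := by ring
    · have := congrArg Subtype.val h
      simp only [Set.Icc.coe_zero] at this
      exact absurd this (by positivity)
  have hJCD := jetConv_of_localComplexBound_of_limits h4 D huseq
  choose aD haD using hJCD
  obtain ⟨Φ, hΦan, hΦlim⟩ := exists_analytic_limit (P := PD)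
    (fun t₀ => by
      obtain ⟨r, hr, δ₁, hδ₁, C, hC⟩ := h4 t₀ D
      exact ⟨r, hr, δ₁, hδ₁, C, fun δ hδ hδ' z hz => hC δ hδ hδ' (PD δ) (hPD δ hδ) z hz⟩)
    (a := aD) (fun k e he => by
      obtain ⟨δ₀, hδ₀, h⟩ := haD k e he
      exact ⟨δ₀, hδ₀, fun δ hδ hδ' => h δ hδ hδ' (PD δ) (hPD δ hδ)⟩)
  have hΦσ : ∀ t : unitInterval, Φ t = c (σ t) := fun t => by
    have h1 : Tendsto (fun δ => (PD δ).eval (t : ℝ)) (𝓝[>] 0) (𝓝 (c (σ t))) := by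
      refine (hlimD t).congr' ?_
      have hev : ∀ᶠ δ in 𝓝[>] (0 : ℝ), 0 < δ := self_mem_nhdsWithin
      filter_upwards [hev] with δ hδ using hPD δ hδ t
    exact tendsto_nhds_unique (hΦlim t) h1
  -- Step 2: the analytic parameter curve `S` and the modulus curve `α = circleParam ∘ S`
  obtain ⟨S, hSan, hSσ⟩ := exists_analytic_chart_inverse
    RandomPlanarGeometry.strictAntiOn_cardyFunction_lamR
    (fun s hs => RandomPlanarGeometry.analyticAt_cardyFunction_lamR hs)
    (fun s hs => RandomPlanarGeometry.deriv_cardyFunction_lamR_ne_zero hs) hΦan hσ hΦσ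
  set α : ℝ → ℂ := fun y => (1 + (S y : ℂ) * Complex.I) ^ 2 / (1 + (S y : ℂ) ^ 2) with hαdef
  have hαβ : ∀ t : unitInterval, α t = β t := fun t => by
    rw [hαdef]; dsimp only; rw [hSσ t, ← hβσ t]
  have hαan : AnalyticOnNhd ℝ α (Icc 0 1) := fun y hy =>
    (RandomPlanarGeometry.analyticAt_circleParam (S y)).comp_of_eq (hSan y hy) rfl
  have hαim : ∀ s ∈ Icc (0 : ℝ) 1, 0 < (α s).im := fun s hs => by
    have h := hαβ ⟨s, hs⟩
    simp only at h
    rw [h]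
    exact hβim _
  refine ⟨α, hαan, hαim, ?_⟩
  -- Step 3: the identification for a rectangle `R'`
  intro R' M hMan hM a ha
  have hM01 : ∀ β : ℂ, 0 < β.im → M β ∈ Ioo (0 : ℝ) 1 := fun β hβ => by
    obtain ⟨Q, ψ, y, hc, hp, hψ⟩ := exists_shear_presentation R' hβ.ne'
    rw [← hM β hβ Q ψ y hc hp hψ]
    exact ConformalRectangle.crossRatio_mem_Ioo_of_isUniformizing hψ
  obtain ⟨P, hP⟩ := hPex R'
  -- the S4w disc at `0` for `R'`
  obtain ⟨r, hr, δ₁, hδ₁, C, hC⟩ := h4 0 R'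
  have h00 : (((0 : unitInterval) : ℝ) : ℂ) = 0 := by simp
  rw [h00] at hC
  have hCP : ∀ δ : ℝ, 0 < δ → δ < δ₁ →
      ∀ z ∈ Metric.ball (0 : ℂ) r, ‖((P δ).map (algebraMap ℝ ℂ)).eval z‖ ≤ C :=
    fun δ hδ hδ' z hz => hC δ hδ hδ' (P δ) (hP δ hδ) z hz
  -- parameters `u m = r₁/(m+2)` inside the disc and the segment, `r₁ = min r 1`
  set r₁ : ℝ := min r 1 with hr₁
  have hr₁0 : 0 < r₁ := lt_min hr one_pos
  set u : ℕ → ℝ := fun m => r₁ / ((m : ℝ) + 2) with hu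
  have hupos : ∀ m, 0 < u m := fun m => by positivity
  have hule : ∀ m, u m ≤ r₁ / 2 := fun m => by
    rw [hu]; dsimp only
    exact div_le_div_of_nonneg_left hr₁0.le (by norm_num) (by linarith [m.cast_nonneg (α := ℝ)])
  have hur : ∀ m, |u m| < r := fun m => by
    rw [abs_of_pos (hupos m)]
    linarith [hule m, min_le_left r 1]
  have hu01 : ∀ m, u m ∈ Icc (0 : ℝ) 1 := fun m =>
    ⟨(hupos m).le, by linarith [hule m, min_le_right r 1]⟩
  have hu0 : Tendsto u atTop (𝓝 0) := by
    have h1 : Tendsto (fun n : ℕ => (n : ℝ) + 2) atTop atTop :=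
      tendsto_natCast_atTop_atTop.atTop_add tendsto_const_nhds
    simpa [hu] using h1.const_div_atTop r₁
  have hune : ∀ m, u m ≠ 0 := fun m => (hupos m).ne'
  -- limits at the `u m` (Target)
  set Lm : ℕ → ℝ := fun m => RandomPlanarGeometry.cardyFunction (M (β ⟨u m, hu01 m⟩)) with hLm
  have hL : ∀ m, Tendsto (fun δ => (P δ).eval (u m)) (𝓝[>] 0) (𝓝 (Lm m)) := fun m => by
    refine (hlimM R' M hM ⟨u m, hu01 m⟩).congr' ?_
    have hev : ∀ᶠ δ in 𝓝[>] (0 : ℝ), 0 < δ := self_mem_nhdsWithin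
    filter_upwards [hev] with δ hδ using hP δ hδ ⟨u m, hu01 m⟩
  -- Vitali on the disc along the reference sequence of meshes
  have hd0 : Tendsto (fun n : ℕ => (1 : ℝ) / ((n : ℝ) + 2)) atTop (𝓝[>] 0) := by
    refine tendsto_nhdsWithin_iff.2 ⟨?_, Eventually.of_forall fun n => ?_⟩
    · have h1 : Tendsto (fun n : ℕ => (n : ℝ) + 2) atTop atTop :=
        tendsto_natCast_atTop_atTop.atTop_add tendsto_const_nhds
      exact h1.const_div_atTop 1
    · show (1 : ℝ) / ((n : ℝ) + 2) ∈ Ioi 0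
      exact mem_Ioi.2 (by positivity)
  obtain ⟨g, hgd, hgu, hgc⟩ := exists_limit_seq hr hδ₁ hCP hu0 hune hur hL hd0
  -- the coefficient limits `a k` are the Taylor coefficients of `g` at `0`
  have hak : ∀ k : ℕ, ((a k : ℝ) : ℂ) = (k.factorial : ℂ)⁻¹ * iteratedDeriv k g 0 := by
    intro k
    have h1 : Tendsto (fun n : ℕ => (P ((1 : ℝ) / ((n : ℝ) + 2))).coeff k) atTop (𝓝 (a k)) := by
      rw [Metric.tendsto_nhds]
      intro e he
      obtain ⟨δ₀, hδ₀, hδ⟩ := ha k e he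
      have h2 : ∀ᶠ n : ℕ in atTop, (1 : ℝ) / ((n : ℝ) + 2) ∈ Ioo 0 δ₀ :=
        hd0 (Ioo_mem_nhdsGT hδ₀)
      exact h2.mono fun n hn => hδ _ hn.1 hn.2 (P _) (hP _ hn.1)
    exact tendsto_nhds_unique ((Complex.continuous_ofReal.tendsto (a k)).comp h1) (hgc k)
  -- Taylor on the disc: `Σ a k s^k = re (g s)` for `0 ≤ s < r`
  have htaylor : ∀ s : ℝ, 0 ≤ s → s < r → HasSum (fun k : ℕ => a k * s ^ k) (g s).re := by
    intro s hs0 hsr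
    have hsB : (s : ℂ) ∈ Metric.ball (0 : ℂ) r := by
      rw [Metric.mem_ball, dist_zero_right, Complex.norm_real, Real.norm_eq_abs, abs_of_nonneg hs0]
      exact hsr
    have hT := Complex.hasSum_taylorSeries_on_ball hgd hsB
    have hfun : (fun n : ℕ => (n.factorial : ℂ)⁻¹ • ((s : ℂ) - 0) ^ n • iteratedDeriv n g 0) =
        fun k : ℕ => (((a k * s ^ k : ℝ)) : ℂ) := by
      funext k
      rw [sub_zero, smul_eq_mul, smul_eq_mul]
      push_cast
      rw [hak k]
      ring
    rw [hfun] at hT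
    have h := Complex.reCLM.hasSum hT
    simp only [Complex.reCLM_apply, Complex.ofReal_re] at h
    exact h
  -- identification of `re ∘ g` with `F ∘ M ∘ α` near `0` (identity theorem through the `u m`)
  set v : ℝ → ℝ := fun s => (g (s : ℂ)).re with hvdef
  set h : ℝ → ℝ := fun s => RandomPlanarGeometry.cardyFunction (M (α s)) with hhdef
  have hh0 : AnalyticAt ℝ h 0 := by
    have h0 : (0 : ℝ) ∈ Icc (0 : ℝ) 1 := left_mem_Icc.2 zero_le_one
    have him := hαim 0 h0
    have h2 : AnalyticAt ℝ (fun s : ℝ => M (α s)) 0 := (hMan _ him).comp_of_eq (hαan 0 h0) rfl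
    exact (RandomPlanarGeometry.analyticOnNhd_cardyFunction_Ioo _ (hM01 _ him)).comp_of_eq h2 rfl
  obtain ⟨ρ₁, hρ₁, hball⟩ := Metric.eventually_nhds_iff_ball.1 hh0.eventually_analyticAt
  set ε : ℝ := min r ρ₁ with hεdef
  have hε : 0 < ε := lt_min hr hρ₁
  have hva : AnalyticOnNhd ℝ v (Metric.ball 0 ε) := fun y hy => by
    have hyr : ((y : ℝ) : ℂ) ∈ Metric.ball (0 : ℂ) r := by
      rw [Metric.mem_ball, dist_zero_right, Complex.norm_real]
      rw [Metric.mem_ball, dist_zero_right] at hy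
      exact hy.trans_le (min_le_left _ _)
    have hga : AnalyticAt ℂ g (y : ℂ) := (hgd.analyticOnNhd Metric.isOpen_ball) _ hyr
    have h1 : AnalyticAt ℝ (fun s : ℝ => g (s : ℂ)) y :=
      (hga.restrictScalars (𝕜 := ℝ)).comp_of_eq (Complex.ofRealCLM.analyticAt y) rfl
    exact (Complex.reCLM.analyticAt _).comp h1
  have hha : AnalyticOnNhd ℝ h (Metric.ball 0 ε) := fun y hy =>
    hball y (Metric.ball_subset_ball (min_le_right _ _) hy)
  have hfreq : ∃ᶠ s in 𝓝[≠] (0 : ℝ), v s = h s := by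
    have hu' : Tendsto u atTop (𝓝[≠] (0 : ℝ)) :=
      tendsto_nhdsWithin_iff.2 ⟨hu0, Eventually.of_forall fun m => hune m⟩
    refine hu'.frequently (Frequently.of_forall fun m => ?_)
    show (g (u m : ℂ)).re = RandomPlanarGeometry.cardyFunction (M (α (u m)))
    rw [hgu m, Complex.ofReal_re, hLm]
    simp only
    have := hαβ ⟨u m, hu01 m⟩
    simp only at this
    rw [this]
  have hEq : EqOn v h (Metric.ball 0 ε) :=
    hva.eqOn_of_preconnected_of_frequently_eq hha (convex_ball _ _).isPreconnected
      (Metric.mem_ball_self hε) hfreq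
  refine ⟨ε, hε, fun s hs0 hsε => ?_⟩
  have hsball : s ∈ Metric.ball (0 : ℝ) ε := by
    rw [Metric.mem_ball, dist_zero_right, Real.norm_eq_abs, abs_of_nonneg hs0]; exact hsε
  have h1 := htaylor s hs0 (hsε.trans_le (min_le_left _ _))
  have h2 : v s = h s := hEq hsball
  rw [hvdef, hhdef] at h2
  simp only at h2
  rwa [h2] at h1

open JetIdentificationOfTarget GoodSetUnivOfGlobalJets JetConvOfLimits in
/-- **Under S4w and the Target, the modulus motion of the corner family is real-analytic**: there
is `α : ℝ → ℂ`, real-analytic on `[0,1]` with values in `ℍ`, such that `CardyMod t (α t)` for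
every `t ∈ [0,1]` (by modulus uniqueness `α t` IS the modulus of `M_t`). -/
theorem exists_analytic_modulus_curve
    (h4 : ∀ (t₀ : unitInterval) (R : ConformalRectangle), ∃ r > 0, ∃ δ₁ > 0, ∃ C : ℝ, ∀ δ : ℝ,
      0 < δ → δ < δ₁ → ∀ p : Polynomial ℝ,
        (∀ t : unitInterval, Percolation.cornerCrossingProb t R δ = p.eval (t : ℝ)) →
        ∀ z ∈ Metric.ball ((t₀ : ℝ) : ℂ) r, ‖(p.map (algebraMap ℝ ℂ)).eval z‖ ≤ C)
    (hT : Summit.CriticalPhenomena.CardyFormulaZ2.Theses.CardySelfDualSegment.Target) :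
    ∃ α : ℝ → ℂ, AnalyticOnNhd ℝ α (Set.Icc 0 1) ∧ (∀ s ∈ Set.Icc (0 : ℝ) 1, 0 < (α s).im) ∧
      ∀ (t : unitInterval) (R R' : ConformalRectangle)
        (φ : ConformalEquiv UpperHalfPlane.upperHalfPlaneSet R.carrier) (x : Fin 4 → ℝ),
        R.carrier = moduliShear (α t) '' R'.carrier →
        (∀ i, R.pt i = moduliShear (α t) (R'.pt i)) → R.IsUniformizing φ x →
        Tendsto (Percolation.cornerCrossingProb t R') (𝓝[>] 0)
          (𝓝 (RandomPlanarGeometry.cardyFunction (RandomPlanarGeometry.crossRatio x))) := by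
  obtain ⟨α, hαan, hαim, hJ⟩ := jetIdentification_of_target h4 hT
  have hJC := fun R' => jetConv_of_localComplexBound_of_limits h4 R'
  -- JC for every `R'` from the Target (limits along `1/(n+2) → 0`)
  have hT' := hT
  rw [target_iff_forall_mem_goodSet] at hT'
  have huseq : ∀ R' : ConformalRectangle, ∃ u : ℕ → unitInterval, Tendsto u atTop (𝓝 0) ∧
      (∀ n, u n ≠ 0) ∧
      ∀ n, ∃ L : ℝ, Tendsto (Percolation.cornerCrossingProb (u n) R') (𝓝[>] 0) (𝓝 L) := by
    intro R'
    have hmem : ∀ n : ℕ, (1 : ℝ) / ((n : ℝ) + 2) ∈ Icc (0 : ℝ) 1 := fun n => by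
      constructor
      · positivity
      · rw [div_le_one (by positivity)]; linarith [n.cast_nonneg (α := ℝ)]
    refine ⟨fun n => ⟨(1 : ℝ) / ((n : ℝ) + 2), hmem n⟩, ?_, fun n h => ?_, fun n => ?_⟩
    · rw [Metric.tendsto_atTop]
      intro ε hε
      obtain ⟨N, hN⟩ := exists_nat_gt (1 / ε)
      refine ⟨N, fun n hn => ?_⟩
      rw [Subtype.dist_eq, Set.Icc.coe_zero, dist_zero_right, Real.norm_eq_abs,
        abs_of_pos (by positivity), div_lt_iff₀ (by positivity)]
      have hN' : (N : ℝ) ≤ n := by exact_mod_cast hn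
      have h1 : 1 / ε < (n : ℝ) + 2 := by linarith
      calc (1 : ℝ) = (1 / ε) * ε := by field_simp
        _ < ((n : ℝ) + 2) * ε := by gcongr
        _ = ε * ((n : ℝ) + 2) := by ring
    · have := congrArg Subtype.val h
      simp only [Set.Icc.coe_zero] at this
      exact absurd this (by positivity)
    · obtain ⟨β, hβ, hC⟩ := hT' (⟨(1 : ℝ) / ((n : ℝ) + 2), hmem n⟩ : unitInterval)
      obtain ⟨Q, ψ, y, hc, hp, hψ⟩ := exists_shear_presentation R' hβ.ne'
      exact ⟨_, hC Q R' ψ y hc hp hψ⟩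
  exact ⟨α, hαan, hαim, fun t =>
    cardyModAt_curve_of_globalJets h4 (fun R' k => hJC R' (huseq R') k) hαan hαim hJ t⟩

end Summit.CriticalPhenomena.CardyFormulaZ2.Theorems
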